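/-
pub-hubbard cell (planner pub-hubbard-r3, gen 14). Ladder R1–R4 with certified numbers; no claim on
`H`/`H₀`. This file certifies NO number.
-/
import Summits.HubbardSuperconductivity.HubbardLadder.PairSourceEnergyCeiling
import HarnessLib

/-!
# The sourced-energy certificate ALONG a sublattice of sides

HONEST FRAMING (cell pub-hubbard, unit R3/R4). Ladder R1–R4 with certified numbers; NO claim on
`H`/`H₀`; this file certifies NO number. It is the producer-facing variant of
`PairSourceEnergyCeiling.lean` (energy-only R4⁻ route #2): the certified slack between the unsourced
`S^z = 0` sector energy and the ground energy WITH a `d`-wave pair source is asked only on the sides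
`L` divisible by a fixed `d` (a translation-invariant trial-state FAMILY gives canonical energy upper
bounds exactly along such a sublattice — e.g. the cell's torus-family node
`luctiUpper_16k_U8_N224kk_ti4ds`, sides `16k` — and the period-8 stripe of the regime fits only sides
`8 ∣ L`). What survives is the `liminf` form of the conclusion: along every admissible ground-state
sequence `liminf_k σ_d²(2k) ≤ s²/(2h²)`, and certificates of every size along one `d` already REFUTE
`d`-wave pair-field long-range order at `(U, δ) = (8, 1/8)` in the summit's `liminf` sense, i.e. they
prove the catalogued conjecture `PureModelStripeCompetition` — but NOT the cell's all-sides target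
`NoDWaveOrderPureU8Eighth` (a `Tendsto` along all `k`), exactly as for the commensurate pair-gap
certificate of `PairGapCeilingAlong.lean`.

## Contents (all sorry-free)

* `pairFieldDensity_le_of_sourcedSlack` — the pointwise form of route #2 with the slack as a
  hypothesis at ONE side: `p_d(L; ψ) ≤ s²/(2h²) + C/L²` (`C` uniform in `L`, depending on `U, μ, s`).
* `PairSourceEnergyCertAlong U N d` — `⟨h > 0, μ, s > 0, L₀, slack ≤ sL² on every side L ≥ L₀ with
  d ∣ L⟩`; `PairSourceEnergyCert.along` (all even sides ⇒ along any even `d`); `.restrict`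
  (`d ∣ d'`); `.ofEnergyRows` — the constructor from the two ENERGY-DENSITY ROWS a producer would
  deliver (an upper row `E_N(L) ≤ e⁺L²` on the sector energy, a lower row `e⁻L² ≤ E₀(sourced)`, the
  exact density `N_L = ρL²` along the sublattice, and `s = e⁺ - μρ - e⁻ > 0`), every hypothesis
  explicit.
* `.pairFieldDensity_le`, `.liminf_dWaveOrderParamSq_le` (`liminf ≤ s²/(2h²)`),
  `pureModelStripeCompetition_of_forall_pairSourceEnergyCertAlong` (certificates of every size along
  one even `d > 0` ⇒ `PureModelStripeCompetition`).
* OPEN node (typed, NOT claimed): `SmallPairSourceResponseAlongSixteenPureU8Eighth` (`d = 16`, the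
  sublattice of the cell's torus-family upper bounds; `8 ∣ 16`); edges from the all-sides node
  `SmallPairSourceResponsePureU8Eighth` and to `PureModelStripeCompetition`;
  `electronNumber_eighth_of_four_dvd` (`N_L = (7/8)L²` exactly when `4 ∣ L`).

## Producer status (labels; nothing is claimed)

Input (a) along `L = 16k` at `t′ = 0`, `n̄ = 7/8`, `U = 8` is the cell's node
`luctiUpper_16k_U8_N224kk_ti4ds` up to two bookkeeping steps that are NOT in the tree for general
`L`: the `fermionRectTorusGraph L L` ↔ `hubbardTorus 2 L` reindexing, and the `S^z = 0` refinement of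
an all-sector ground-energy bound (every `SU(2)` multiplet meets `S^z = 0`; alternatively the
trial-state family is restated in the `(N/2, N/2)` sector it lives in). Input (b), a
translation-invariant LOWER bound on the grand-canonical energy WITH the pair source (particle number
broken to fermion parity), has no producer and no chartered engine. Magnitudes as in
`PairSourceEnergyCeiling.lean`: informative only if the sourced two-sided bracket `g` and source `h`
satisfy `g/h + M̄(h) < 1.62`, `M̄(h)` the averaged pair-amplitude response (so that `s²/(2h²)` beats
the kinematic `128/π⁴ ≈ 1.314` of `limsup_dWaveOrderParamSq_le_kinematic`; Yang's `63/32` is weaker),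
physically meaningful only near `10⁻³ t` energy densities; with PERFECT rows the `h → ∞` limit of the
ceiling is `256/π⁴`, twice the kinematic value, so the certificate is informative at finite `h` only.

Sources: T. Koma, H. Tasaki, J. Stat. Phys. 76 (1994) 745, Thm 2.2 and §1; T. A. Kaplan, P. Horsch,
W. von der Linden, J. Phys. Soc. Jpn. 58 (1989) 3894; H. Tasaki, H. Watanabe (2021), Theorem (10) and
the discussion after eq. (11) (subsequence / `liminf` readings of energy–LRO inequalities); M. Qin et
al., Phys. Rev. X 10 (2020) 031016, §IV.
-/

noncomputable section

namespace Summit.HubbardSuperconductivity.HubbardLadder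

open Matrix Filter Literature.Probability.LatticeModels
open Literature.MathematicalPhysics.QuantumLattice
open Literature.Barriers.HubbardSuperconductivity (PureModelStripeCompetition)
open scoped ComplexOrder Topology

/-! ## §1 The pointwise bound with the slack as a hypothesis -/

/-- **Route #2 at one side.** For real `U, μ`, `h > 0`, `s > 0` there is `C ≥ 0` (uniform in `L`)
such that on every torus of side `L ≥ 1`, every normalised ground state `ψ` of `H(1,U)` in a sector
`(n, S^z = 0)` whose sourced slack is at most `sL²`,
`E_n(L) - μn - E₀(H(1,U) - μN - h(Δ_d + Δ_d†)) ≤ sL²`, has `p_d(L; ψ) ≤ s²/(2h²) + C/L²`.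
[cite: KomaTasaki1994, Theorem 2.2] [cite: KaplanHorschVonDerLinden1989] -/
theorem pairFieldDensity_le_of_sourcedSlack (U μ h s : ℝ) (hh : 0 < h) (hs : 0 < s) :
    ∃ C : ℝ, 0 ≤ C ∧ ∀ (L : ℕ) [NeZero L], 1 ≤ L →
      ∀ (n : ℕ) (ψ : Fock (Orb (FermionTorus 2 L))), star ψ ⬝ᵥ ψ = 1 →
        IsGroundStateInSector (pureHubbard U L) n 0 ψ →
        (hubbardTorus 2 L 1 U).minEnergyOn (szSector n 0) - μ * n -
            (dWaveSourceTorus L U μ h).groundEnergy ≤ s * (L : ℝ) ^ 2 →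
        pairFieldDensity L ψ ≤ s ^ 2 / (2 * h ^ 2) + C / (L : ℝ) ^ 2 := by
  obtain ⟨B₂, Bp, hB₂, hBp, hmain⟩ := two_mul_re_pair_le_of_sourcedSlack
  refine ⟨B₂ * (1 + |U| + |μ|) / (4 * s) + Bp / 2, by positivity,
    fun L _ hL1 n ψ hψ1 hgs hslack => ?_⟩
  have hLpos : (0 : ℝ) < (L : ℝ) := by exact_mod_cast (show 0 < L by omega)
  have hSL : 0 < s * (L : ℝ) ^ 2 := by positivity
  have key := hmain L U μ h (s * (L : ℝ) ^ 2) hh hSL n ψ hψ1 hgs hslack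
  obtain ⟨L', rfl⟩ : ∃ L', L = L' + 1 := ⟨L - 1, by omega⟩
  set ℓ : ℝ := ((L' + 1 : ℕ) : ℝ) with hℓ
  have hℓ0 : (0 : ℝ) < ℓ := by positivity
  have hℓ1 : (1 : ℝ) ≤ ℓ := by rw [hℓ]; exact_mod_cast hL1
  have hℓ2 : (1 : ℝ) ≤ ℓ ^ 2 := by nlinarith
  have hS' : pairFieldDensity (L' + 1) ψ =
      (expect ((pairField dWaveFormFactor (L' + 1))ᴴ * pairField dWaveFormFactor (L' + 1)) ψ).re /
        ℓ ^ 4 := rfl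
  rw [hS']
  set R : ℝ := (expect ((pairField dWaveFormFactor (L' + 1))ᴴ *
    pairField dWaveFormFactor (L' + 1)) ψ).re with hR
  have hs0 : s ≠ 0 := hs.ne'
  have hh0 : h ≠ 0 := hh.ne'
  have hℓne : ℓ ≠ 0 := hℓ0.ne'
  have e1 : B₂ * (1 + |U| + |μ|) * ℓ ^ 2 / (2 * (s * ℓ ^ 2)) =
      B₂ * (1 + |U| + |μ|) / (2 * s) := by
    field_simp
    try ring
  have e2 : (s * ℓ ^ 2) ^ 2 / h ^ 2 = 2 * (s ^ 2 / (2 * h ^ 2) * ℓ ^ 4) := by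
    field_simp
    try ring
  rw [e1, e2] at key
  have hA : 0 ≤ B₂ * (1 + |U| + |μ|) / (4 * s) := by positivity
  have hAℓ : B₂ * (1 + |U| + |μ|) / (4 * s) ≤ B₂ * (1 + |U| + |μ|) / (4 * s) * ℓ ^ 2 :=
    le_mul_of_one_le_right hA hℓ2
  have hRle : R ≤ s ^ 2 / (2 * h ^ 2) * ℓ ^ 4 + (B₂ * (1 + |U| + |μ|) / (4 * s) + Bp / 2) * ℓ ^ 2 := by
    have e3 : B₂ * (1 + |U| + |μ|) / (2 * s) = 2 * (B₂ * (1 + |U| + |μ|) / (4 * s)) := by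
      field_simp
      try ring
    rw [e3] at key
    nlinarith
  calc R / ℓ ^ 4
      ≤ (s ^ 2 / (2 * h ^ 2) * ℓ ^ 4 + (B₂ * (1 + |U| + |μ|) / (4 * s) + Bp / 2) * ℓ ^ 2) / ℓ ^ 4 :=
        div_le_div_of_nonneg_right hRle (by positivity)
    _ = s ^ 2 / (2 * h ^ 2) + (B₂ * (1 + |U| + |μ|) / (4 * s) + Bp / 2) / ℓ ^ 2 := by
        field_simp
        try ring

/-! ## §2 The certificate along the sides `d ∣ L` -/

/-- **Sourced-energy certificate ALONG the sides divisible by `d`.** Reals `h > 0`, `μ`, `s > 0`, a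
side `L₀`, and the slack bound
`E_{N_L}(L) - μN_L - E₀(H(1,U) - μN - h(Δ_d + Δ_d†)) ≤ sL²` on every side `L ≥ L₀` with `d ∣ L`
(`E_{N}(L)` the minimum of `H(1,U)` on the sector `(N, S^z = 0)` of the `L × L` torus).
[cite: KomaTasaki1994, §1 and Theorem 2.2] [cite: QinEtAl2020, §IV] -/
structure PairSourceEnergyCertAlong (U : ℝ) (N : ℕ → ℕ) (d : ℕ) where
  /-- the source strength -/
  h : ℝ
  h_pos : 0 < h
  /-- the chemical potential of the grand-canonical lower bound -/
  μ : ℝ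
  /-- the slack density -/
  s : ℝ
  s_pos : 0 < s
  /-- the side from which the rows hold -/
  L₀ : ℕ
  bound : ∀ (L : ℕ) [NeZero L], L₀ ≤ L → d ∣ L →
    (hubbardTorus 2 L 1 U).minEnergyOn (szSector (N L) 0) - μ * (N L) -
      (dWaveSourceTorus L U μ h).groundEnergy ≤ s * (L : ℝ) ^ 2

/-- An all-even-sides certificate is a certificate along every even `d`. [folklore] -/
def PairSourceEnergyCert.along {U : ℝ} {N : ℕ → ℕ} (c : PairSourceEnergyCert U N) {d : ℕ}
    (hde : Even d) : PairSourceEnergyCertAlong U N d where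
  h := c.h
  h_pos := c.h_pos
  μ := c.μ
  s := c.s
  s_pos := c.s_pos
  L₀ := c.L₀
  bound L _ hL hdL := c.bound L hL ((even_iff_two_dvd.1 hde).trans hdL |> even_iff_two_dvd.2)

namespace PairSourceEnergyCertAlong

variable {U : ℝ} {N : ℕ → ℕ} {d : ℕ} (c : PairSourceEnergyCertAlong U N d)

/-- The ceiling constant `s²/(2h²)`. [folklore] -/
def ceiling : ℝ := c.s ^ 2 / (2 * c.h ^ 2)

/-- Restriction to a coarser sublattice `d ∣ d'`. [folklore] -/
def restrict {d' : ℕ} (hd' : d ∣ d') : PairSourceEnergyCertAlong U N d' where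
  h := c.h
  h_pos := c.h_pos
  μ := c.μ
  s := c.s
  s_pos := c.s_pos
  L₀ := c.L₀
  bound L _ hL hdL := c.bound L hL (hd'.trans hdL)

/-- **The constructor from two energy-density rows** (every hypothesis explicit): an UPPER row on
the `S^z = 0` sector energy `E_{N_L}(L) ≤ e⁺L²`, a LOWER row on the sourced grand-canonical energy
`e⁻L² ≤ E₀(H(1,U) - μN - h(Δ_d + Δ_d†))`, both on the sides `L ≥ L₀` with `d ∣ L`, the exact density
`N_L = ρL²` there, and `s := e⁺ - μρ - e⁻ > 0`. [cite: KomaTasaki1994, §1] -/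
def ofEnergyRows (h : ℝ) (hh : 0 < h) (μ eU eL ρ : ℝ) (L₀ : ℕ) (hs : 0 < eU - μ * ρ - eL)
    (hN : ∀ L, L₀ ≤ L → d ∣ L → (N L : ℝ) = ρ * (L : ℝ) ^ 2)
    (hup : ∀ (L : ℕ) [NeZero L], L₀ ≤ L → d ∣ L →
      (hubbardTorus 2 L 1 U).minEnergyOn (szSector (N L) 0) ≤ eU * (L : ℝ) ^ 2)
    (hlo : ∀ (L : ℕ) [NeZero L], L₀ ≤ L → d ∣ L →
      eL * (L : ℝ) ^ 2 ≤ (dWaveSourceTorus L U μ h).groundEnergy) :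
    PairSourceEnergyCertAlong U N d where
  h := h
  h_pos := hh
  μ := μ
  s := eU - μ * ρ - eL
  s_pos := hs
  L₀ := L₀
  bound L _ hL hdL := by
    have h1 := hup L hL hdL
    have h2 := hlo L hL hdL
    have h3 := hN L hL hdL
    rw [h3]
    nlinarith

/-- **Pointwise density bound along the sublattice**: `p_d(L; ψ) ≤ s²/(2h²) + C/L²` for every
normalised sector ground state on every side `L ≥ max L₀ 1` with `d ∣ L`.
[cite: KomaTasaki1994, Theorem 2.2] -/
theorem pairFieldDensity_le : ∃ C : ℝ, 0 ≤ C ∧ ∀ (L : ℕ), c.L₀ ≤ L → 1 ≤ L → d ∣ L →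
    ∀ ψ : Fock (Orb (FermionTorus 2 L)), star ψ ⬝ᵥ ψ = 1 →
      IsGroundStateInSector (pureHubbard U L) (N L) 0 ψ →
      pairFieldDensity L ψ ≤ c.ceiling + C / (L : ℝ) ^ 2 := by
  obtain ⟨C, hC0, hC⟩ := pairFieldDensity_le_of_sourcedSlack U c.μ c.h c.s c.h_pos c.s_pos
  refine ⟨C, hC0, fun L hL hL1 hdL ψ hψ1 hgs => ?_⟩
  haveI : NeZero L := ⟨by omega⟩
  exact hC L hL1 (N L) ψ hψ1 hgs (c.bound L hL hdL)

/-- **`liminf` of the order parameter under a certificate along an even `d > 0`**: along every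
admissible ground-state sequence of `(pureHubbard U, N)`,
`liminf_k dWaveOrderParamSq ψ k ≤ s²/(2h²)` — along `k = (d/2)·j` the order parameter is
`p_d(d·j) ≤ s²/(2h²) + C/(d j)²`, so it is frequently below every level above the ceiling.
[cite: TasakiWatanabe2021, Theorem (10) and the discussion after eq. (11)]
[cite: KomaTasaki1994, Theorem 2.2] -/
theorem liminf_dWaveOrderParamSq_le (hd : 0 < d) (hde : Even d)
    (ψ : ∀ L, Fock (Orb (FermionTorus 2 L)))
    (hψ : ∀ L, Even L → star (ψ L) ⬝ᵥ ψ L = 1 ∧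
      IsGroundStateInSector (pureHubbard U L) (N L) 0 (ψ L)) :
    liminf (fun k => dWaveOrderParamSq ψ k) atTop ≤ c.ceiling := by
  obtain ⟨e, he⟩ := hde
  have he0 : 0 < e := by omega
  obtain ⟨C, hC0, hC⟩ := c.pairFieldDensity_le
  have h2 : ∀ j, 2 * (e * j) = d * j := by intro j; rw [he]; ring
  have hej : ∀ j, j ≤ e * j := fun j => Nat.le_mul_of_pos_left j he0
  -- the subsequence `j ↦ k = e·j`, `L = 2k = d·j`
  have hcast : Tendsto (fun j : ℕ => (((2 * (e * j) : ℕ) : ℝ))) atTop atTop := by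
    refine tendsto_natCast_atTop_atTop.comp ?_
    refine tendsto_atTop_mono (fun j => ?_) tendsto_id
    exact le_trans (hej j) (Nat.le_mul_of_pos_left _ (by norm_num))
  have hden : Tendsto (fun j : ℕ => (((2 * (e * j) : ℕ) : ℝ)) ^ 2) atTop atTop :=
    (tendsto_pow_atTop two_ne_zero).comp hcast
  have hlim : Tendsto (fun j : ℕ => C / (((2 * (e * j) : ℕ) : ℝ)) ^ 2) atTop (𝓝 0) :=
    tendsto_const_nhds.div_atTop hden
  -- eventually along the subsequence: σ_d²(e j) ≤ ceiling + C/(2ej)²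
  have hsub : ∀ᶠ j in atTop,
      dWaveOrderParamSq ψ (e * j) ≤ c.ceiling + C / (((2 * (e * j) : ℕ) : ℝ)) ^ 2 := by
    filter_upwards [eventually_ge_atTop (max c.L₀ 1)] with j hj
    have hj0 : c.L₀ ≤ j := le_trans (le_max_left _ _) hj
    have hj1 : 1 ≤ j := le_trans (le_max_right _ _) hj
    have hk : 1 ≤ e * j := le_trans hj1 (hej j)
    have hL0 : c.L₀ ≤ 2 * (e * j) := le_trans hj0 (le_trans (hej j) (by omega))
    have hL1 : 1 ≤ 2 * (e * j) := by omega
    have hdL : d ∣ 2 * (e * j) := ⟨j, h2 j⟩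
    rw [dWaveOrderParamSq_eq_pairFieldDensity ψ hk]
    exact hC (2 * (e * j)) hL0 hL1 hdL (ψ (2 * (e * j))) (hψ _ (even_two_mul _)).1
      (hψ _ (even_two_mul _)).2
  -- bounded below (eventually nonnegative) along the full sequence
  have hbdd : IsBoundedUnder (· ≥ ·) atTop (fun k => dWaveOrderParamSq ψ k) := by
    refine ⟨0, eventually_map.2 (eventually_atTop.2 ⟨1, fun k hk => ?_⟩)⟩
    show 0 ≤ dWaveOrderParamSq ψ k
    rw [dWaveOrderParamSq_eq_pairFieldDensity ψ hk]
    exact pairFieldDensity_nonneg _ _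
  refine le_of_forall_gt_imp_ge_of_dense fun ε hε => ?_
  have hη : 0 < ε - c.ceiling := sub_pos.2 hε
  have hev : ∀ᶠ j in atTop, dWaveOrderParamSq ψ (e * j) ≤ ε := by
    filter_upwards [hsub, hlim.eventually (eventually_le_nhds hη)] with j hj hj'
    linarith
  obtain ⟨j₁, hj₁⟩ := eventually_atTop.1 hev
  have hfreq : ∃ᶠ k in atTop, dWaveOrderParamSq ψ k ≤ ε :=
    frequently_atTop.2 fun n =>
      ⟨e * max n j₁, le_trans (le_max_left _ _) (hej _), hj₁ _ (le_max_right _ _)⟩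
  exact liminf_le_of_frequently_le hfreq hbdd

end PairSourceEnergyCertAlong

/-! ## §3 Certificates of every size along one `d` refute `d`-wave LRO at `(8, 1/8)` -/

/-- **One certificate ⇒ one number (the R4 reading along a sublattice).** For the admissible
ground-state sequences of the summit's matrix at `(U, δ) = (8, 1/8)` verbatim,
`liminf_k σ_d²(2k) ≤ s²/(2h²)`. [cite: KomaTasaki1994, Theorem 2.2] [cite: QinEtAl2020, §IV] -/
theorem liminf_dWaveOrderParamSq_le_of_pairSourceEnergyCertAlong {d : ℕ} (hd : 0 < d)
    (hde : Even d) (c : PairSourceEnergyCertAlong 8 (electronNumber (1 / 8)) d)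
    (N : ℕ → ℕ) (ψ : ∀ L, Fock (Orb (FermionTorus 2 L)))
    (hNψ : ∀ L, Even L → N L = 2 * ⌊(1 - 1 / 8) * (L : ℝ) ^ 2 / 2⌋₊ ∧ star (ψ L) ⬝ᵥ ψ L = 1 ∧
        IsGroundStateInSector (hubbardTorus 2 L 1 8) (N L) 0 (ψ L)) :
    liminf (fun k => dWaveOrderParamSq ψ k) atTop ≤ c.s ^ 2 / (2 * c.h ^ 2) := by
  refine c.liminf_dWaveOrderParamSq_le hd hde ψ fun L hL => ?_
  obtain ⟨hN, h1, hgs⟩ := hNψ L hL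
  rw [hN] at hgs
  exact ⟨h1, hgs⟩

/-- **Certificates of every size along one even `d > 0` ⇒ `PureModelStripeCompetition`.** LRO in
the summit's sense is a positive `liminf` over ALL `k`; along the admissible ground-state sequence
that `exists_groundStateSeq_pure` supplies, §2 puts that `liminf` below every `ε > 0`.
[cite: QinEtAl2020, §IV p. 11] [cite: TasakiWatanabe2021, discussion after eq. (11)] -/
theorem pureModelStripeCompetition_of_forall_pairSourceEnergyCertAlong {d : ℕ} (hd : 0 < d)
    (hde : Even d)
    (h : ∀ ε > 0, ∃ c : PairSourceEnergyCertAlong 8 (electronNumber (1 / 8)) d, c.ceiling ≤ ε) :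
    PureModelStripeCompetition := by
  intro hAt
  obtain ⟨ψ, hψ⟩ := exists_groundStateSeq_pure 8 (1 / 8) (by norm_num)
  have hL : 0 < liminf (fun k => dWaveOrderParamSq ψ k) atTop :=
    hAt (electronNumber (1 / 8)) ψ fun L hL => ⟨rfl, hψ L hL⟩
  have hle : liminf (fun k => dWaveOrderParamSq ψ k) atTop ≤ 0 := by
    refine le_of_forall_pos_le_add fun ε hε => ?_
    obtain ⟨c, hc⟩ := h ε hε
    rw [zero_add]
    exact (c.liminf_dWaveOrderParamSq_le hd hde ψ hψ).trans hc
  exact absurd hL (not_lt.2 hle)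

/-! ## §4 The open node on the sublattice `16 ∣ L` and its edges -/

/-- Along `4 ∣ L` the summit's electron number at `δ = 1/8` is EXACTLY `(7/8)L²`:
`2⌊(7/8)(4m)²/2⌋ = 14m²`. [folklore] -/
theorem electronNumber_eighth_of_four_dvd {L : ℕ} (hL : 4 ∣ L) :
    (electronNumber (1 / 8) L : ℝ) = 7 / 8 * (L : ℝ) ^ 2 := by
  obtain ⟨m, rfl⟩ := hL
  have h : (1 - 1 / 8 : ℝ) * ((4 * m : ℕ) : ℝ) ^ 2 / 2 = ((7 * m ^ 2 : ℕ) : ℝ) := by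
    push_cast; ring
  rw [electronNumber, h, Nat.floor_natCast]
  push_cast; ring

/-- OPEN (typed, NOT claimed; no instance is known and none is requested) — **small sourced-energy
response of the pure 2D Hubbard model at `U/t = 8`, hole doping `1/8`, ALONG the sides `16 ∣ L`**:
for every `ε > 0` a `PairSourceEnergyCertAlong 8 (electronNumber (1/8)) 16` with `s²/(2h²) ≤ ε`.
The sublattice `16 ∣ L` is the one on which the cell's translation-invariant torus-family energy
upper bounds live (`luctiUpper_16k_U8_N224kk_ti4ds`) and is commensurate with the period-8 stripe.
Implied by the all-sides node `SmallPairSourceResponsePureU8Eighth`; implies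
`PureModelStripeCompetition` (below) but not, as typed, the cell target `NoDWaveOrderPureU8Eighth`.
[cite: QinEtAl2020, §IV p. 11] [cite: KomaTasaki1994, §1] [status: open] -/
@[conjecture] def SmallPairSourceResponseAlongSixteenPureU8Eighth : Prop :=
  ∀ ε > 0, ∃ c : PairSourceEnergyCertAlong 8 (electronNumber (1 / 8)) 16, c.ceiling ≤ ε

/-- The all-sides node implies the node along `16 ∣ L`. [folklore] -/
theorem smallPairSourceResponseAlongSixteen_of_smallPairSourceResponse
    (h : SmallPairSourceResponsePureU8Eighth) : SmallPairSourceResponseAlongSixteenPureU8Eighth := by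
  intro ε hε
  obtain ⟨c, hc⟩ := h ε hε
  exact ⟨c.along ⟨8, rfl⟩, hc⟩

/-- **`SmallPairSourceResponseAlongSixteenPureU8Eighth ⇒ PureModelStripeCompetition`.**
[cite: QinEtAl2020, §IV p. 11] -/
theorem pureModelStripeCompetition_of_smallPairSourceResponseAlongSixteen
    (h : SmallPairSourceResponseAlongSixteenPureU8Eighth) : PureModelStripeCompetition :=
  pureModelStripeCompetition_of_forall_pairSourceEnergyCertAlong (by norm_num) ⟨8, rfl⟩ h

end Summit.HubbardSuperconductivity.HubbardLadder

end
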